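import Summits.QuantumFields.BalabanUV.Beta.GAN24.ContactFaceJumpStaircase
import Summits.QuantumFields.BalabanUV.Beta.SymAveragingHessianCounts

/-!
# `BalabanUV.Beta.GAN24.SymContactFaceJump` — binder row G-an2-4 ∕ (CONV-C), TRANSFER-III, the (III′) S-slot (b) of the END, born-Λ contact letter `hCg` (road-P2 M.104's
# 3rd hypothesis), TABLE HALF («mksym lane» of `S-SLOT-LETTERS-SIZING-g89.md` §2), PART 1: **THE TWO-BLOCK SUPPORT OF an1's (0.4)-SYMMETRISED LINEAR COUNT `symLinCountAt ρ`
# AND THE FACE-JUMP LETTERS OF THE FOUR-SITE GAUGE WEIGHT AGAINST IT** — the decl-by-decl twin of MY g60 `ContactFaceJump` (§1 support, §2 block-constant gauge functions) and of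
# `ContactFaceJumpStaircase.abs_weight_mul_dz_staircase_mul_linCountAt_le` (two staircases), with `linCountAt ↦ symLinCountAt`, `linKerAt ↦ symLinKerAt`
# (G-an2-4 CRUX TEAM (2), leaf prover `b2b-balaban-gan24-formalise-leaf-01`, gen 90)

WHY.  At (III′) the born-Λ table is `SLam Lc c (symHessFFAt ρ Lc)` (`CombBornSector.combFreshAt` on an1's record `SymTables.H = symHessFFAt ρ_c`); after leaf-02 g47's sym Ward law
`SymHessianGaugeLegContact.tsum_dz_mul_SLam_symHessFFAt` the contact cells see the table ONLY through `q¹_sym = symLinKerAt ρ` (`= symLinCountAt ∕ ((d+1)!·L^{d+1})`), exactly as the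
(E) cells see `hessFFAt ρ` only through `q¹ = linKerAt ρ`.  The (E) face-jump analysis (leaf-02's PART 3 `ContactLambdaEntryBound` via `ContactFaceJumpCommutator`) needs of `q¹` its
TWO-BLOCK SUPPORT: both endpoints of every bond of every rooted contour word of the coarse bond `(μ, y)` have block label `y` or `y + e_μ`.  For the symmetrised words
`gammaPAt σ σ′ ρ A L μ y b = Γ^σ ∪ [x, x + L e_μ] ∪ (Γ^{σ′})⁻¹` this is the same three-piece argument, the permuted comb `axialP σ A y x = axial (P1g σ A) (σ⁻¹y) (σ⁻¹x)` being handled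
by MY `bonds_axial` on the pulled-back form and the permutation invariance of the coordinate hull.

WHAT IS PROVED (generic `d`, box root `ρ = toSite r`, `1 ≤ L`; [folklore] lattice bookkeeping):
* §1 `bonds_axialP` (both endpoints of every bond of `axialP σ A y x` lie in `Hull y x`), **`twoBlock_gammaPAt`**, **`symLinCountAt_eq_zero_of_not_twoBlock`**, `symLinKerAt_eq_zero_of_not_twoBlock`.
* §2 block-constant gauge functions against the sym count: **`abs_weight_mul_symLinCountAt_le`**, `abs_dz_mul_symLinCountAt_le`, **`weight_mul_dz_mul_symLinCountAt_eq_zero`** (the two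
  coarse jumps never multiply) — MY `abs_fourSite_le ∕ abs_twoSite_le ∕ fourSite_mul_twoSite_eq_zero ∕ blk_root ∕ blk_farRoot` BY NAME.
* §3 two staircases: **`abs_weight_mul_dz_staircase_mul_symLinCountAt_le`** (MY `staircase_split ∕ abs_hplus_jump_le` BY NAME).
NOT HERE: the commutator over bonds (PART 2 `SymContactFaceJumpCommutator`), the cells, any count.

NOT IN PRINT; OUR BOOKKEEPING ([folklore]; 0 `def`, 0 cited fact, 0 `def … : Prop`, 0 sorry).  HONEST FRAMING (cell contract, verbatim): «discharging `BetaPertH` makes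
Bałaban's UV stability UNCONDITIONAL — a real constructive-QFT result; it is NOT the continuum limit and NOT the Clay problem.»  HONEST DEPENDENCY (verbatim): «continuum YM
on T⁴ ⇐ BetaPertH ∧ nine spine estimates (0/9 proved); BetaPertH ⇐ (D1) ∧ (D4) ∧ CAP+tail; G-an2-4 gates asym, D1 and NE2/3/4.»  Discharges NO letter of M.104 by itself;
NEVER «G-an2-4 closed» as (CONV-C); NOT D1, NOT `BetaPertH`, NOT continuum, NOT Clay.  2026-08-28; no existing file touched.
-/

noncomputable section

open Finset
open scoped BigOperators
open Literature.MathematicalPhysics.QuantumFieldTheory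
open Literature.MathematicalPhysics.QuantumFieldTheory.Balaban1983to89
open Literature.MathematicalPhysics.QuantumFieldTheory.Balaban1983to89.Beta
open AffineAveraging (Form0 Form1 Site box toSite unitVec unitVec_apply)
open AveragingContours (blk blk_block seg segUp segDown rev axial)
open AveragingHessianKernels (Bond δ1 δ1_apply Hull mem_segUp)
open Summit.QuantumFields.BalabanUV.Beta.KernelPermutation (psite psite_apply psite_symm_apply psite_add)
open Summit.QuantumFields.BalabanUV.Beta.ResolventPermutation (psite_unitVec)
open Summit.QuantumFields.BalabanUV.Beta.SymAveragingHessianCounts (P1g P1g_apply axialP gammaPAt symLinU symLinCountAt symLinKerAt)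
open Summit.QuantumFields.BalabanUV.Beta.GAN24.ContactFaceJump (bonds_axial blk_eq_of_hull_block abs_fourSite_le blk_root blk_farRoot abs_twoSite_le fourSite_mul_twoSite_eq_zero)
open Summit.QuantumFields.BalabanUV.Beta.GAN24.ContactFaceJumpStaircase (staircase_split abs_hplus_jump_le)

namespace Summit.QuantumFields.BalabanUV.Beta.GAN24.SymContactFaceJump

variable {d : ℕ}

/-! ## §1 Both endpoints of every bond of the symmetrised rooted words lie in the two blocks `y`, `y + e_μ` -/

section Support

variable {R : Type*} [AddCommGroup R]

/-- [folklore] Both endpoints of every bond of the permuted comb `axialP σ A y x` lie in the coordinate hull of `y` and `x` (MY `bonds_axial` on the pulled-back form; the hull is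
permutation invariant, `psite σ (x′ + e_κ) = psite σ x′ + e_{σ κ}`). -/
theorem bonds_axialP (σ : Equiv.Perm (Fin (d + 1))) (A : Form1 (d + 1) R) (y x : Site (d + 1)) :
    ∀ a ∈ axialP σ A y x, ∃ (κ' : Fin (d + 1)) (x' : Site (d + 1)),
      Hull y x x' ∧ Hull y x (x' + unitVec κ') ∧ (a = A κ' x' ∨ a = -A κ' x') := by
  intro a ha
  obtain ⟨κ, w, h1, h2, h3⟩ := bonds_axial (P1g σ A) ((psite σ).symm y) ((psite σ).symm x) a ha
  have hull : ∀ v : Site (d + 1), Hull ((psite σ).symm y) ((psite σ).symm x) v → Hull y x (psite σ v) := by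
    intro v hv i
    simpa only [Hull, psite_symm_apply, psite_apply, Equiv.apply_symm_apply] using hv (σ.symm i)
  refine ⟨σ κ, psite σ w, hull w h1, ?_, ?_⟩
  · have e : psite σ w + unitVec (σ κ) = psite σ (w + unitVec κ) := by rw [psite_add, psite_unitVec]
    rw [e]; exact hull _ h2
  · simpa only [P1g_apply] using h3

/-- NOT IN PRINT; OUR BOOKKEEPING.  **BOTH ENDPOINTS OF EVERY BOND OF THE SYMMETRISED ROOTED WORD `γ^{σ,σ′}_{(μ,y),x}` HAVE BLOCK LABEL `y` OR `y + e_μ`** (box root,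
`x ∈ B(y)`): the `σ`-comb from the root lies in the block `y`, the straight part climbs from the block `y` into the block `y + e_μ`, the returning `σ′`-comb lies in the block
`y + e_μ` — MY `twoBlock_gammaCAt` with `bonds_axialP` for the two combs. -/
theorem twoBlock_gammaPAt {L : ℕ} (hL : 1 ≤ L) (σ σ' : Equiv.Perm (Fin (d + 1))) (A : Form1 (d + 1) R) (μ : Fin (d + 1)) (y : Site (d + 1))
    {r b : Fin (d + 1) → ℕ} (hr : r ∈ box (d + 1) L) (hb : b ∈ box (d + 1) L) :
    ∀ a ∈ gammaPAt σ σ' (toSite r) A L μ y b, ∃ (κ' : Fin (d + 1)) (x' : Site (d + 1)),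
      (blk L x' = y ∨ blk L x' = y + unitVec μ) ∧ (blk L (x' + unitVec κ') = y ∨ blk L (x' + unitVec κ') = y + unitVec μ) ∧
      (a = A κ' x' ∨ a = -A κ' x') := by
  have hb' : ∀ i, b i < L := by simpa [AffineAveraging.box, Fintype.mem_piFinset, Finset.mem_range] using hb
  intro a ha
  simp only [gammaPAt, List.mem_append] at ha
  rcases ha with (ha | ha) | ha
  · -- the `σ`-comb from the root: inside the block `y`
    obtain ⟨κ', x', h1, h2, h3⟩ := bonds_axialP σ A _ _ a ha
    have e1 := blk_eq_of_hull_block y hr hb 0 (x' := x') (by simpa using h1)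
    have e2 := blk_eq_of_hull_block y hr hb 0 (x' := x' + unitVec κ') (by simpa using h2)
    rw [sub_zero] at e1 e2
    exact ⟨κ', x', Or.inl e1, Or.inl e2, h3⟩
  · -- the straight part: `L` bonds in direction `μ` from `L·y + b`
    obtain ⟨s, hs, rfl⟩ := mem_segUp ha
    have hL0 : (L : ℤ) ≠ 0 := by exact_mod_cast (show L ≠ 0 by omega)
    have key : ∀ t : ℕ, t ≤ L → blk L ((L : ℤ) • y + toSite b + (t : ℤ) • unitVec μ) = y ∨
        blk L ((L : ℤ) • y + toSite b + (t : ℤ) • unitVec μ) = y + unitVec μ := by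
      intro t ht
      by_cases hbt : b μ + t < L
      · left
        funext i
        simp only [blk, Pi.add_apply, Pi.smul_apply, smul_eq_mul, toSite, unitVec_apply]
        have hi := hb' i
        split_ifs with hiμ
        · subst hiμ
          rw [mul_one, add_assoc, add_comm ((L : ℤ) * y i), Int.add_mul_ediv_left _ _ hL0,
            Int.ediv_eq_zero_of_lt (by positivity) (by omega), zero_add]
        · rw [mul_zero, add_zero, add_comm ((L : ℤ) * y i), Int.add_mul_ediv_left _ _ hL0,
            Int.ediv_eq_zero_of_lt (by positivity) (by exact_mod_cast hi), zero_add]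
      · right
        funext i
        simp only [blk, Pi.add_apply, Pi.smul_apply, smul_eq_mul, toSite, unitVec_apply]
        have hi := hb' i
        split_ifs with hiμ
        · subst hiμ
          have e : (L : ℤ) * y i + (b i : ℤ) + (t : ℤ) * 1 = ((b i : ℤ) + t - L) + L * (y i + 1) := by ring
          rw [e, Int.add_mul_ediv_left _ _ hL0, Int.ediv_eq_zero_of_lt (by omega) (by omega), zero_add]
        · rw [mul_zero, add_zero, add_zero, add_comm ((L : ℤ) * y i), Int.add_mul_ediv_left _ _ hL0,
            Int.ediv_eq_zero_of_lt (by positivity) (by exact_mod_cast hi), zero_add]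
    refine ⟨μ, _, key s hs.le, ?_, Or.inl rfl⟩
    have e : (L : ℤ) • y + toSite b + (s : ℤ) • unitVec μ + unitVec μ = (L : ℤ) • y + toSite b + ((s + 1 : ℕ) : ℤ) • unitVec μ := by
      rw [Nat.cast_succ, add_smul, one_smul, add_assoc]
    rw [e]
    exact key (s + 1) (by omega)
  · -- the returning `σ′`-comb: inside the block `y + e_μ` (letters negated and reversed)
    unfold AveragingContours.rev at ha
    rw [List.mem_reverse] at ha
    obtain ⟨a', ha', rfl⟩ := List.mem_map.1 ha
    obtain ⟨κ', x', h1, h2, h3⟩ := bonds_axialP σ' A _ _ a' ha'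
    have ev : ∀ w : Site (d + 1), (L : ℤ) • y + w + (L : ℤ) • unitVec μ = (L : ℤ) • (y + unitVec μ) + w + 0 := by
      intro w; rw [smul_add]; abel
    rw [ev, ev] at h1 h2
    have e1 := blk_eq_of_hull_block (y + unitVec μ) hr hb 0 h1
    have e2 := blk_eq_of_hull_block (y + unitVec μ) hr hb 0 h2
    rw [sub_zero] at e1 e2
    refine ⟨κ', x', Or.inr e1, Or.inr e2, ?_⟩
    rcases h3 with h3 | h3
    · right; rw [h3]
    · left; rw [h3, neg_neg]

/-- NOT IN PRINT; OUR BOOKKEEPING.  **THE TWO-BLOCK SUPPORT OF `q¹_sym,ρ` (integer count)**: if NOT both endpoints of the bond `f` have block label in `{y, y+e_μ}`, the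
symmetrised rooted count vanishes — no word `γ^{σ,σ}_x` of the coarse bond `(μ,y)` passes through `f`. -/
theorem symLinCountAt_eq_zero_of_not_twoBlock {L : ℕ} (hL : 1 ≤ L) {μ : Fin (d + 1)} {y : Site (d + 1)} {r : Fin (d + 1) → ℕ} (hr : r ∈ box (d + 1) L)
    {f : Bond (d + 1)}
    (h : ¬ ((blk L f.2 = y ∨ blk L f.2 = y + unitVec μ) ∧ (blk L (f.2 + unitVec f.1) = y ∨ blk L (f.2 + unitVec f.1) = y + unitVec μ))) :
    symLinCountAt (toSite r) L μ y f = 0 := by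
  unfold symLinCountAt symLinU
  refine Finset.sum_eq_zero fun σ _ => Finset.sum_eq_zero fun b hb => List.sum_eq_zero fun a ha => ?_
  obtain ⟨κ', x', h1, h2, h3⟩ := twoBlock_gammaPAt hL σ σ (δ1 f) μ y hr hb a ha
  have h0 : δ1 f κ' x' = 0 := by
    rw [δ1_apply, if_neg]
    rintro rfl
    exact h ⟨h1, h2⟩
  rcases h3 with h3 | h3
  · rw [h3, h0]
  · rw [h3, h0, neg_zero]

/-- [folklore] The same for the real kernel `q¹_sym,ρ = symLinCountAt ∕ ((d+1)!·L^{d+1})`. -/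
theorem symLinKerAt_eq_zero_of_not_twoBlock {L : ℕ} (hL : 1 ≤ L) {μ : Fin (d + 1)} {y : Site (d + 1)} {r : Fin (d + 1) → ℕ} (hr : r ∈ box (d + 1) L)
    {f : Bond (d + 1)}
    (h : ¬ ((blk L f.2 = y ∨ blk L f.2 = y + unitVec μ) ∧ (blk L (f.2 + unitVec f.1) = y ∨ blk L (f.2 + unitVec f.1) = y + unitVec μ))) :
    symLinKerAt (toSite r) L μ y f = 0 := by
  rw [symLinKerAt, symLinCountAt_eq_zero_of_not_twoBlock hL hr h, Int.cast_zero, zero_div]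

end Support

/-! ## §2 Block-constant gauge functions against the symmetrised count -/

section BlockConstant

/-- NOT IN PRINT; OUR BOOKKEEPING.  **FOR A BLOCK-CONSTANT GAUGE FUNCTION THE FOUR-SITE WEIGHT AGAINST `symLinCountAt` IS A FACE JUMP** (box root, EVERY bond `(b,z)`):
`ψ = h ∘ blk L` ⇒ `|w₄(ψ; b,z; μ,y)·symLinCountAt ρ L μ y (b,z)| ≤ |h(y+e_μ) − h y|·|symLinCountAt ρ L μ y (b,z)|`. -/
theorem abs_weight_mul_symLinCountAt_le {L : ℕ} (hL : 1 ≤ L) {r : Fin (d + 1) → ℕ} (hr : r ∈ box (d + 1) L) {ψ : Site (d + 1) → ℝ} (h : Site (d + 1) → ℝ)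
    (hψ : ∀ u, ψ u = h (blk L u)) (μ : Fin (d + 1)) (y : Site (d + 1)) (b : Fin (d + 1)) (z : Site (d + 1)) :
    |(ψ z + ψ (z + unitVec b) - ψ ((L : ℤ) • y + toSite r) - ψ ((L : ℤ) • y + toSite r + (L : ℤ) • unitVec μ))
        * (symLinCountAt (toSite r) L μ y (b, z) : ℝ)|
      ≤ |h (y + unitVec μ) - h y| * |(symLinCountAt (toSite r) L μ y (b, z) : ℝ)| := by
  simp only [hψ, blk_root y hr, blk_farRoot y μ hr]
  rw [abs_mul]
  by_cases hq : (blk L z = y ∨ blk L z = y + unitVec μ) ∧ (blk L (z + unitVec b) = y ∨ blk L (z + unitVec b) = y + unitVec μ)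
  · exact mul_le_mul_of_nonneg_right (abs_fourSite_le h hq.1 hq.2) (abs_nonneg _)
  · rw [symLinCountAt_eq_zero_of_not_twoBlock (f := (b, z)) hL hr hq, Int.cast_zero, abs_zero, mul_zero, mul_zero]

/-- NOT IN PRINT; OUR BOOKKEEPING.  **THE GRADIENT OF A BLOCK-CONSTANT GAUGE FUNCTION ON THE SUPPORT OF `q¹_sym,ρ` IS AT MOST THE ONE FACE JUMP** (box root, EVERY bond):
`ψ = h ∘ blk L` ⇒ `|(ψ(z+e_b) − ψ z)·symLinCountAt ρ L μ y (b,z)| ≤ |h(y+e_μ) − h y|·|symLinCountAt ρ L μ y (b,z)|`. -/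
theorem abs_dz_mul_symLinCountAt_le {L : ℕ} (hL : 1 ≤ L) {r : Fin (d + 1) → ℕ} (hr : r ∈ box (d + 1) L) {ψ : Site (d + 1) → ℝ} (h : Site (d + 1) → ℝ)
    (hψ : ∀ u, ψ u = h (blk L u)) (μ : Fin (d + 1)) (y : Site (d + 1)) (b : Fin (d + 1)) (z : Site (d + 1)) :
    |(ψ (z + unitVec b) - ψ z) * (symLinCountAt (toSite r) L μ y (b, z) : ℝ)| ≤ |h (y + unitVec μ) - h y| * |(symLinCountAt (toSite r) L μ y (b, z) : ℝ)| := by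
  simp only [hψ]
  rw [abs_mul]
  by_cases hq : (blk L z = y ∨ blk L z = y + unitVec μ) ∧ (blk L (z + unitVec b) = y ∨ blk L (z + unitVec b) = y + unitVec μ)
  · exact mul_le_mul_of_nonneg_right (abs_twoSite_le h hq.1 hq.2) (abs_nonneg _)
  · rw [symLinCountAt_eq_zero_of_not_twoBlock (f := (b, z)) hL hr hq, Int.cast_zero, abs_zero, mul_zero, mul_zero]

/-- NOT IN PRINT; OUR BOOKKEEPING.  **ON THE SUPPORT OF `q¹_sym,ρ` THE FACE JUMPS OF TWO BLOCK-CONSTANT GAUGE FUNCTIONS NEVER MULTIPLY** (box root, EVERY bond `(b,z)`):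
`ψ_a = h_a ∘ blk L`, `ψ_b = h_b ∘ blk L` ⇒ `w₄(ψ_a; b,z; μ,y)·(ψ_b(z+e_b) − ψ_b z)·symLinCountAt ρ L μ y (b,z) = 0`. -/
theorem weight_mul_dz_mul_symLinCountAt_eq_zero {L : ℕ} (hL : 1 ≤ L) {r : Fin (d + 1) → ℕ} (hr : r ∈ box (d + 1) L) {ψa ψb : Site (d + 1) → ℝ}
    (ha hb : Site (d + 1) → ℝ) (hψa : ∀ u, ψa u = ha (blk L u)) (hψb : ∀ u, ψb u = hb (blk L u))
    (μ : Fin (d + 1)) (y : Site (d + 1)) (b : Fin (d + 1)) (z : Site (d + 1)) :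
    (ψa z + ψa (z + unitVec b) - ψa ((L : ℤ) • y + toSite r) - ψa ((L : ℤ) • y + toSite r + (L : ℤ) • unitVec μ))
        * (ψb (z + unitVec b) - ψb z) * (symLinCountAt (toSite r) L μ y (b, z) : ℝ) = 0 := by
  simp only [hψa, hψb, blk_root y hr, blk_farRoot y μ hr]
  by_cases hq : (blk L z = y ∨ blk L z = y + unitVec μ) ∧ (blk L (z + unitVec b) = y ∨ blk L (z + unitVec b) = y + unitVec μ)
  · rw [fourSite_mul_twoSite_eq_zero ha hb hq.1 hq.2, zero_mul]
  · rw [symLinCountAt_eq_zero_of_not_twoBlock (f := (b, z)) hL hr hq, Int.cast_zero, mul_zero]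

end BlockConstant

/-! ## §3 Two staircases: the four-site weight of one times the gradient of the other, against the symmetrised count -/

section Staircase

variable {Lc : ℕ}

/-- NOT IN PRINT; OUR BOOKKEEPING.  **FOUR-SITE WEIGHT OF ONE STAIRCASE × GRADIENT OF ANOTHER ON THE SUPPORT OF `q¹_sym,ρ`** (one step `L = Lc`, box root; staircases
`ψ_a = Σ_{s<na+1} Ga s ∘ blk (Lc^s)`, `ψ_b = Σ_{s<nb+1} Gb s ∘ blk (Lc^s)`; `J_a, J_b` the sums of the coarse face jumps across the bond `(μ,y)`):
`|w₄(ψ_a; b,z; μ,y)·(ψ_b(z+e_b) − ψ_b z)·symLinCountAt| ≤ (|w₄(Ga 0)|·(|Gb 0 (z+e_b) − Gb 0 z| + J_b) + J_a·|Gb 0 (z+e_b) − Gb 0 z|)·|symLinCountAt|` — NO `J_a·J_b` term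
(MY `ContactFaceJumpStaircase.abs_weight_mul_dz_staircase_mul_linCountAt_le` with §2's letters). -/
theorem abs_weight_mul_dz_staircase_mul_symLinCountAt_le (hLc : 1 ≤ Lc) {r : Fin (d + 1) → ℕ} (hr : r ∈ box (d + 1) Lc) (Ga Gb : ℕ → Site (d + 1) → ℝ) (na nb : ℕ)
    {ψa ψb : Site (d + 1) → ℝ} (hψa : ∀ u, ψa u = ∑ s ∈ Finset.range (na + 1), Ga s (blk (Lc ^ s) u))
    (hψb : ∀ u, ψb u = ∑ s ∈ Finset.range (nb + 1), Gb s (blk (Lc ^ s) u))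
    (μ : Fin (d + 1)) (y : Site (d + 1)) (b : Fin (d + 1)) (z : Site (d + 1)) :
    |(ψa z + ψa (z + unitVec b) - ψa ((Lc : ℤ) • y + toSite r) - ψa ((Lc : ℤ) • y + toSite r + (Lc : ℤ) • unitVec μ))
        * (ψb (z + unitVec b) - ψb z) * (symLinCountAt (toSite r) Lc μ y (b, z) : ℝ)|
      ≤ (|Ga 0 z + Ga 0 (z + unitVec b) - Ga 0 ((Lc : ℤ) • y + toSite r) - Ga 0 ((Lc : ℤ) • y + toSite r + (Lc : ℤ) • unitVec μ)|
            * (|Gb 0 (z + unitVec b) - Gb 0 z| + ∑ s ∈ Finset.range nb, |Gb (s + 1) (blk (Lc ^ s) (y + unitVec μ)) - Gb (s + 1) (blk (Lc ^ s) y)|)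
          + (∑ s ∈ Finset.range na, |Ga (s + 1) (blk (Lc ^ s) (y + unitVec μ)) - Ga (s + 1) (blk (Lc ^ s) y)|) * |Gb 0 (z + unitVec b) - Gb 0 z|)
        * |(symLinCountAt (toSite r) Lc μ y (b, z) : ℝ)| := by
  set q : ℝ := (symLinCountAt (toSite r) Lc μ y (b, z) : ℝ) with hq
  set hpa : Site (d + 1) → ℝ := fun y' => ∑ s ∈ Finset.range na, Ga (s + 1) (blk (Lc ^ s) y') with hhpa
  set hpb : Site (d + 1) → ℝ := fun y' => ∑ s ∈ Finset.range nb, Gb (s + 1) (blk (Lc ^ s) y') with hhpb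
  have hψa' : ∀ u, ψa u = Ga 0 u + hpa (blk Lc u) := fun u => by rw [hψa, staircase_split]
  have hψb' : ∀ u, ψb u = Gb 0 u + hpb (blk Lc u) := fun u => by rw [hψb, staircase_split]
  -- the four pieces
  set A0 : ℝ := Ga 0 z + Ga 0 (z + unitVec b) - Ga 0 ((Lc : ℤ) • y + toSite r) - Ga 0 ((Lc : ℤ) • y + toSite r + (Lc : ℤ) • unitVec μ) with hA0
  set A1 : ℝ := hpa (blk Lc z) + hpa (blk Lc (z + unitVec b)) - hpa (blk Lc ((Lc : ℤ) • y + toSite r))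
    - hpa (blk Lc ((Lc : ℤ) • y + toSite r + (Lc : ℤ) • unitVec μ)) with hA1
  set B0 : ℝ := Gb 0 (z + unitVec b) - Gb 0 z with hB0
  set B1 : ℝ := hpb (blk Lc (z + unitVec b)) - hpb (blk Lc z) with hB1
  set Ja : ℝ := ∑ s ∈ Finset.range na, |Ga (s + 1) (blk (Lc ^ s) (y + unitVec μ)) - Ga (s + 1) (blk (Lc ^ s) y)| with hJa
  set Jb : ℝ := ∑ s ∈ Finset.range nb, |Gb (s + 1) (blk (Lc ^ s) (y + unitVec μ)) - Gb (s + 1) (blk (Lc ^ s) y)| with hJb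
  have e : (ψa z + ψa (z + unitVec b) - ψa ((Lc : ℤ) • y + toSite r) - ψa ((Lc : ℤ) • y + toSite r + (Lc : ℤ) • unitVec μ))
        * (ψb (z + unitVec b) - ψb z) * q
      = A0 * B0 * q + A0 * (B1 * q) + B0 * (A1 * q) + A1 * B1 * q := by
    simp only [hψa', hψb', hA0, hA1, hB0, hB1]; ring
  -- the ΔΔ piece vanishes, the mixed pieces carry ONE coarse jump each
  have h11 : A1 * B1 * q = 0 :=
    weight_mul_dz_mul_symLinCountAt_eq_zero hLc hr (ψa := fun u => hpa (blk Lc u)) (ψb := fun u => hpb (blk Lc u)) hpa hpb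
      (fun _ => rfl) (fun _ => rfl) μ y b z
  have h1q : |A1 * q| ≤ Ja * |q| :=
    (abs_weight_mul_symLinCountAt_le hLc hr (ψ := fun u => hpa (blk Lc u)) hpa (fun _ => rfl) μ y b z).trans
      (mul_le_mul_of_nonneg_right (by rw [hhpa]; exact abs_hplus_jump_le Ga na μ y) (abs_nonneg _))
  have hB1q : |B1 * q| ≤ Jb * |q| :=
    (abs_dz_mul_symLinCountAt_le hLc hr (ψ := fun u => hpb (blk Lc u)) hpb (fun _ => rfl) μ y b z).trans
      (mul_le_mul_of_nonneg_right (by rw [hhpb]; exact abs_hplus_jump_le Gb nb μ y) (abs_nonneg _))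
  rw [e, h11, add_zero]
  calc |A0 * B0 * q + A0 * (B1 * q) + B0 * (A1 * q)|
      ≤ |A0 * B0 * q| + |A0 * (B1 * q)| + |B0 * (A1 * q)| := abs_add_three _ _ _
    _ = |A0| * |B0| * |q| + |A0| * |B1 * q| + |B0| * |A1 * q| := by
        have e1 : |A0 * B0 * q| = |A0| * |B0| * |q| := by rw [abs_mul, abs_mul]
        rw [e1, abs_mul A0 (B1 * q), abs_mul B0 (A1 * q)]
    _ ≤ |A0| * |B0| * |q| + |A0| * (Jb * |q|) + |B0| * (Ja * |q|) := by
        gcongr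
    _ = (|A0| * (|B0| + Jb) + Ja * |B0|) * |q| := by ring

end Staircase

end Summit.QuantumFields.BalabanUV.Beta.GAN24.SymContactFaceJump

end
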